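import Summits.QuantumFields.BalabanUV.Beta.GAN24.TransverseFluxReflection
import Literature.MathematicalPhysics.QuantumFieldTheory.Balaban1983to89.Beta.SecondOrderResponse

/-!
# `BalabanUV.Beta.GAN24.TransverseFluxReflectionMultiplier` — binder row G-an2-4 ∕ (CONV-C), the (S) row ∕ (W-γ) one level up (RULING R-gan24p1-g27-1 B (viii)), supplier side:
# **THE DATUM-AXIS REFLECTION LAW OF THE MULTIPLIER COLUMNS — the coarse twin of leaf-06 g49's `TransverseFluxReflection`: at the centred root (`Lc` odd), for every level `j`,
# every datum `(ν, y)` and every multiplier direction `ρ ≠ ν`, `colM G_j Lc ν y ρ w = −colM G_j Lc ν y ρ w̃` with `w̃` the reflection of `w` about the MIDPOINT of the datum bond;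
# hence every reflection-invariant coarse weight — transverse coarse hyperplanes `{w_μ = c}`, single-coordinate weights `f(w_μ)`, `μ ≠ ν` — reads `0` on the transverse
# multiplier legs; plus the bound-free form of the field-leg lemma**
# (G-an2-4 formalisation swarm → CRUX TEAM (2), seat `b2b-balaban-gan24-formalise-leaf-02`, gen 60, INTENT 4; asked for by leaf-06 g49 W-3 l.49203 «(b) `colM_datumRefl_ctr` ∕
# `tsum_slabInd_mul_colM_transverse` is YOURS to file as the corollary over (γ) — GO now, asked: the (C2′) assembly (δ2b) pairs faces against `C_j h = c·𝒬ᵀ colM G_{j+1}(e)`»)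

NOT IN PRINT; OUR BOOKKEEPING ([folklore] packaging BY NAME of an2's `AxialDressingRooted.refK_coDressKBmAt_KInvStep` ∕ `shiftK_coDressKBmAt_KInvStep` (reflection and block-translation
invariance of the co-dressed step resolvent at the centred root), lit-balaban's `ResolventReflection.bref ∕ mref_zsmul ∕ reflSign_*`, leaf-06 g49's `TransverseFluxReflection.colH_refl_of_ne ∕
bref_apply_of_ne ∕ bref_self_sub_apply_of_ne`, an4's `OneStepKernelFamily.colH_translate`; 0 `def`, 0 cited fact, 0 `def … : Prop`, 0 sorry).  PROVENANCE: the `colM` half of this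
seat's withdrawn INTENT 2 `ResponseColumnTransverseFlux` (CLAIMS l.48914 — the field-leg half was found independently and simultaneously by leaf-06 g49 as (γ) `TransverseFluxReflection`,
which is its home; W-6 l.49158), re-based on (γ)'s letters.
HONEST FRAMING (cell contract, verbatim): «discharging `BetaPertH` makes Bałaban's UV stability UNCONDITIONAL — a real constructive-QFT result; it is NOT the continuum limit and
NOT the Clay problem.»  HONEST DEPENDENCY (verbatim): «continuum YM on T⁴ ⇐ BetaPertH ∧ nine spine estimates (0/9 proved); BetaPertH ⇐ (D1) ∧ (D4) ∧ CAP+tail; G-an2-4 gates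
asym, D1 and NE2/3/4.»

WHAT (generic `d`; centred root, `Lc` odd; `G_j = coDressKBmAt (toSite (ctrOff (d+1) Lc)) Lc (KInvStep Lc j)`, every `j`; datum `(ν, y)`; `t := bref ν ν y − y`, supported on the coordinate `ν`).
* §1 `colM_translate` (any `K` with `shiftK (−N•t) K = K`: `colM K N ν (y+t) ρ (w+t) = colM K N ν y ρ w`); **`colM_refl`** (every axis `α`:
  `colM G_j Lc ν y ρ w = reflSign α ρ·reflSign α ν·colM G_j Lc ν (bref α ν y) ρ (bref α ρ w)`); `colM_refl_of_ne` (`α = ν`, `ρ ≠ ν`: sign `−1`); **`colM_datumRefl`**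
  (`colM G_j Lc ν y ρ w = −colM G_j Lc ν y ρ (bref ν ρ w − t)`: reflection about the midpoint of the datum bond, `(bref ν ρ w − t)_ν = 2·y_ν + 1 − w_ν`).
* §2 **`tsum_mul_colM_eq_zero_of_reflInvariant`** (`W (bref ν ρ w − t) = W w ⇒ Σ'_w W w·colM G_j Lc ν y ρ w = 0`, `ρ ≠ ν`; NO bound, NO summability — re-indexing by the involution);
  `relabel_apply_of_ne`; **`tsum_coordWeight_mul_colM_transverse`** (any `f(w_μ)`, `μ ≠ ν`); **`tsum_slabInd_mul_colM_transverse`** (transverse coarse hyperplane sums vanish).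
* §3 the field legs, bound-free: **`tsum_mul_colH_eq_zero_of_reflInvariant`** (`κ ≠ μ′`, ANY `W` with `W (bref μ′ κ u − Lc•t) = W u`), `tsum_mul_colH_eq_zero_of_indep` (any `W` blind to `u_{μ′}`).
Asserts NO value of any resolvent column beyond these symmetries; off-centre roots NOT claimed; NOTHING of (C2′) ∕ `hX` ∕ (W-γ)_{k≥1} ∕ (S) above level 0 ∕ (Q-R) ∕ (DL) ∕ (LT) ∕ «T2Shape» ∕
(hW, hWall) discharged; NEVER «G-an2-4 closed» as (CONV-C); NOT D1, NOT `BetaPertH`, NOT continuum, NOT Clay.  2026-08-23; no existing file touched.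
-/

noncomputable section

open Finset
open Literature.MathematicalPhysics.QuantumFieldTheory
open Literature.MathematicalPhysics.QuantumFieldTheory.Balaban1983to89
open Literature.MathematicalPhysics.QuantumFieldTheory.Balaban1983to89.Beta
open ExpKernelCalculus (Site MKer shiftK)
open AffineAveraging (box toSite unitVec unitVec_apply)
open AveragingContoursRooted (ctrOff ctrOff_mem_box)
open PolarizationSign (reflSign)
open KernelReflection (refK refK_apply)
open ResolventReflection (bref bref_apply bref_bref mref_zsmul Φ Φ_r_inl Φ_r_inr Φ_s_inl Φ_s_inr reflSign_of_ne reflSign_self)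
open OneStepResolventKernel (Fib)
open OneStepKernelFamily (KInvStep colH colH_translate)
open SecondOrderResponse (colM)
open Summit.QuantumFields.BalabanUV.Beta.AxialDressingRooted (coDressKBmAt refK_coDressKBmAt_KInvStep shiftK_coDressKBmAt_KInvStep)
open Summit.QuantumFields.BalabanUV.Beta.GAN24.TransverseFluxReflection (bref_apply_of_ne bref_self_sub_apply_of_ne colH_refl_of_ne)

namespace Summit.QuantumFields.BalabanUV.Beta.GAN24.TransverseFluxReflectionMultiplier

variable {d : ℕ} {Lc : ℕ} [NeZero Lc]

/-! ## §1 The entrywise reflection law of the multiplier columns -/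

omit [NeZero Lc] in
/-- [folklore] **BLOCK COVARIANCE OF THE MULTIPLIER COLUMNS**: for a kernel invariant under the coarse translations (`shiftK (−N•t) K = K`), translating the datum and the
multiplier leg by the same coarse vector changes nothing: `colM K N ν (y + t) ρ (w + t) = colM K N ν y ρ w`. -/
theorem colM_translate {N : ℕ} {K : MKer (d + 1) (Fib d)} (hKs : ∀ t, shiftK (-((N : ℤ) • t)) K = K) (ν : Fin (d + 1)) (y t : Site (d + 1))
    (ρ : Fin (d + 1)) (w : Site (d + 1)) : colM K N ν (y + t) ρ (w + t) = colM K N ν y ρ w := by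
  have h := congrFun (congrFun (congrFun (congrFun (hKs t) ((N : ℤ) • (w + t))) ((N : ℤ) • (y + t))) (Sum.inr ρ)) (Sum.inr ν)
  simp only [shiftK, smul_add, add_neg_cancel_right] at h
  simp only [colM, smul_add]
  exact h.symm

/-- NOT IN PRINT; OUR BOOKKEEPING.  **THE ENTRYWISE REFLECTION LAW OF THE MULTIPLIER COLUMNS** of `G_j = coDressKBmAt (toSite (ctrOff (d+1) Lc)) Lc (KInvStep Lc j)` (`Lc` odd,
every `j`, every axis `α`): `colM G_j Lc ν y ρ w = reflSign α ρ·reflSign α ν·colM G_j Lc ν (bref α ν y) ρ (bref α ρ w)` — an2's `refK_coDressKBmAt_KInvStep` on the `(inr ρ, inr ν)`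
block, both legs at coarse points (`mref_zsmul`: a multiplier leg is a coarse bond, reflected by the coarse `bref`). -/
theorem colM_refl (hLc : Odd Lc) (j : ℕ) (α ν ρ : Fin (d + 1)) (y w : Site (d + 1)) :
    colM (coDressKBmAt (toSite (ctrOff (d + 1) Lc)) Lc (KInvStep (d := d) Lc j)) Lc ν y ρ w
      = reflSign α ρ * reflSign α ν * colM (coDressKBmAt (toSite (ctrOff (d + 1) Lc)) Lc (KInvStep (d := d) Lc j)) Lc ν (bref α ν y) ρ (bref α ρ w) := by
  have h := congrFun (congrFun (congrFun (congrFun (refK_coDressKBmAt_KInvStep (d := d) hLc j α) ((Lc : ℤ) • w)) ((Lc : ℤ) • y)) (Sum.inr ρ)) (Sum.inr ν)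
  simp only [refK_apply, Φ_r_inr, Φ_s_inr, mref_zsmul] at h
  simp only [colM]
  exact h.symm

/-- NOT IN PRINT; OUR BOOKKEEPING.  **THE TRANSVERSE MULTIPLIER LEGS FLIP SIGN UNDER THE REFLECTION ALONG THE DATUM AXIS**: for `ρ ≠ ν`,
`colM G_j Lc ν y ρ w = −colM G_j Lc ν (bref ν ν y) ρ (bref ν ρ w)`. -/
theorem colM_refl_of_ne (hLc : Odd Lc) (j : ℕ) {ν ρ : Fin (d + 1)} (hρ : ρ ≠ ν) (y w : Site (d + 1)) :
    colM (coDressKBmAt (toSite (ctrOff (d + 1) Lc)) Lc (KInvStep (d := d) Lc j)) Lc ν y ρ w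
      = -colM (coDressKBmAt (toSite (ctrOff (d + 1) Lc)) Lc (KInvStep (d := d) Lc j)) Lc ν (bref ν ν y) ρ (bref ν ρ w) := by
  rw [colM_refl hLc j ν ν ρ y w, reflSign_of_ne hρ, reflSign_self]
  ring

/-- NOT IN PRINT; OUR BOOKKEEPING.  **… AND THE REFLECTED DATUM IS CARRIED BACK BY A COARSE TRANSLATION ALONG THE DATUM AXIS**: with `t := bref ν ν y − y` (supported on the
coordinate `ν`), `colM G_j Lc ν y ρ w = −colM G_j Lc ν y ρ (bref ν ρ w − t)` for `ρ ≠ ν` — the multiplier leg is reflected about the MIDPOINT of the datum bond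
(`(bref ν ρ w − t)_ν = 2·y_ν + 1 − w_ν`, other coordinates unchanged). -/
theorem colM_datumRefl (hLc : Odd Lc) (j : ℕ) {ν ρ : Fin (d + 1)} (hρ : ρ ≠ ν) (y w : Site (d + 1)) :
    colM (coDressKBmAt (toSite (ctrOff (d + 1) Lc)) Lc (KInvStep (d := d) Lc j)) Lc ν y ρ w
      = -colM (coDressKBmAt (toSite (ctrOff (d + 1) Lc)) Lc (KInvStep (d := d) Lc j)) Lc ν y ρ (bref ν ρ w - (bref ν ν y - y)) := by
  rw [colM_refl_of_ne hLc j hρ y w]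
  have e : bref ν ν y = y + (bref ν ν y - y) := by abel
  conv_lhs => rw [e, show bref ν ρ w = (bref ν ρ w - (bref ν ν y - y)) + (bref ν ν y - y) by abel]
  rw [colM_translate (shiftK_coDressKBmAt_KInvStep (toSite (ctrOff (d + 1) Lc)) j) ν y (bref ν ν y - y) ρ (bref ν ρ w - (bref ν ν y - y))]

/-! ## §2 Reflection-invariant coarse weights read nothing on the transverse multiplier legs -/

/-- NOT IN PRINT; OUR BOOKKEEPING.  **A REFLECTION-INVARIANT COARSE WEIGHT READS NOTHING ON THE TRANSVERSE MULTIPLIER LEGS** (`Lc` odd, centred root, every `j`, datum `(ν, y)`,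
`ρ ≠ ν`): if `W (bref ν ρ w − (bref ν ν y − y)) = W w` for every `w`, then `Σ'_w W w·colM G_j Lc ν y ρ w = 0` — NO bound and NO summability hypothesis (the relabelling
`w ↦ bref ν ρ w − t` is an involution of the coarse lattice, and re-indexing a `tsum` by an equivalence is unconditional). -/
theorem tsum_mul_colM_eq_zero_of_reflInvariant (hLc : Odd Lc) (j : ℕ) {ν ρ : Fin (d + 1)} (hρ : ρ ≠ ν) (y : Site (d + 1)) {W : Site (d + 1) → ℝ}
    (hW : ∀ w, W (bref ν ρ w - (bref ν ν y - y)) = W w) :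
    ∑' w, W w * colM (coDressKBmAt (toSite (ctrOff (d + 1) Lc)) Lc (KInvStep (d := d) Lc j)) Lc ν y ρ w = 0 := by
  set t : Site (d + 1) := bref ν ν y - y with ht
  set e : Site (d + 1) ≃ Site (d + 1) := (Function.Involutive.toPerm (bref ν ρ) (bref_bref ν ρ)).trans (Equiv.subRight t) with hedef
  have he : ∀ w : Site (d + 1), e w = bref ν ρ w - t := fun w => rfl
  set S := ∑' w, W w * colM (coDressKBmAt (toSite (ctrOff (d + 1) Lc)) Lc (KInvStep (d := d) Lc j)) Lc ν y ρ w with hS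
  have h1 : S = -S := by
    calc S = ∑' w, -(W (e w) * colM (coDressKBmAt (toSite (ctrOff (d + 1) Lc)) Lc (KInvStep (d := d) Lc j)) Lc ν y ρ (e w)) := by
            refine tsum_congr fun w => ?_
            rw [he, hW w, colM_datumRefl hLc j hρ y w]
            ring
      _ = -∑' w, W (e w) * colM (coDressKBmAt (toSite (ctrOff (d + 1) Lc)) Lc (KInvStep (d := d) Lc j)) Lc ν y ρ (e w) := tsum_neg
      _ = -S := by rw [hS, e.tsum_eq (fun w => W w * colM (coDressKBmAt (toSite (ctrOff (d + 1) Lc)) Lc (KInvStep (d := d) Lc j)) Lc ν y ρ w)]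
  linarith

omit [NeZero Lc] in
/-- [folklore] The relabelling `w ↦ bref ν ρ w − (bref ν ν y − y)` does not move the coordinates other than `ν`. -/
theorem relabel_apply_of_ne {ν ρ μ : Fin (d + 1)} (hμ : μ ≠ ν) (y w : Site (d + 1)) : (bref ν ρ w - (bref ν ν y - y)) μ = w μ := by
  rw [Pi.sub_apply, bref_apply_of_ne ν ρ w hμ, bref_self_sub_apply_of_ne ν y hμ, sub_zero]

/-- NOT IN PRINT; OUR BOOKKEEPING.  **TRANSVERSE SINGLE-COORDINATE WEIGHTS ON THE MULTIPLIER LEGS**: `Σ'_w f(w_μ)·colM G_j Lc ν y ρ w = 0` for `μ ≠ ν`, `ρ ≠ ν`, ANY `f : ℤ → ℝ`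
(`Lc` odd, centred root, every `j`, every datum `(ν, y)`). -/
theorem tsum_coordWeight_mul_colM_transverse (hLc : Odd Lc) (j : ℕ) {ν μ ρ : Fin (d + 1)} (hμ : μ ≠ ν) (hρ : ρ ≠ ν) (f : ℤ → ℝ) (y : Site (d + 1)) :
    ∑' w : Site (d + 1), f (w μ) * colM (coDressKBmAt (toSite (ctrOff (d + 1) Lc)) Lc (KInvStep (d := d) Lc j)) Lc ν y ρ w = 0 :=
  tsum_mul_colM_eq_zero_of_reflInvariant hLc j hρ y fun w => by rw [relabel_apply_of_ne hμ]

/-- NOT IN PRINT; OUR BOOKKEEPING.  **THE TRANSVERSE COARSE HYPERPLANE SUMS OF THE MULTIPLIER RESPONSE VANISH**: `Σ'_w 𝟙[w_μ = c]·colM G_j Lc ν y ρ w = 0` for `μ ≠ ν`, `ρ ≠ ν`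
(every `c`, `y`, `j`; `Lc` odd, centred root) — the coarse twin of `TransverseFluxReflection.tsum_slabInd_mul_colH_transverse`. -/
theorem tsum_slabInd_mul_colM_transverse (hLc : Odd Lc) (j : ℕ) {ν μ ρ : Fin (d + 1)} (hμ : μ ≠ ν) (hρ : ρ ≠ ν) (c : ℤ) (y : Site (d + 1)) :
    ∑' w : Site (d + 1), (if w μ = c then (1 : ℝ) else 0) * colM (coDressKBmAt (toSite (ctrOff (d + 1) Lc)) Lc (KInvStep (d := d) Lc j)) Lc ν y ρ w = 0 :=
  tsum_coordWeight_mul_colM_transverse hLc j hμ hρ (fun z : ℤ => if z = c then (1 : ℝ) else 0) y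

/-! ## §3 The field legs: reflection-invariant weights with NO bound (a corollary over `TransverseFluxReflection`) -/

/-- NOT IN PRINT; OUR BOOKKEEPING.  **A REFLECTION-INVARIANT FINE WEIGHT READS NOTHING ON THE TRANSVERSE FIELD LEGS — NO BOUND NEEDED**: for `κ ≠ μ′` and ANY `W` with
`W (bref μ′ κ u − Lc•(bref μ′ μ′ y − y)) = W u`, `Σ'_u W u·colH G_j Lc μ′ y κ u = 0` (leaf-06 g49's `colH_refl_of_ne` ⨾ `colH_translate`, then re-indexing by the involution;
`TransverseFluxReflection.tsum_coordWeight_mul_colH_transverse` is the case `W = f(u_μ)` with `f` bounded — the bound is not needed). -/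
theorem tsum_mul_colH_eq_zero_of_reflInvariant (hLc : Odd Lc) (j : ℕ) {μ' κ : Fin (d + 1)} (hκ : κ ≠ μ') (y : Site (d + 1)) {W : Site (d + 1) → ℝ}
    (hW : ∀ u, W (bref μ' κ u - (Lc : ℤ) • (bref μ' μ' y - y)) = W u) :
    ∑' u, W u * colH (coDressKBmAt (toSite (ctrOff (d + 1) Lc)) Lc (KInvStep (d := d) Lc j)) Lc μ' y κ u = 0 := by
  set t : Site (d + 1) := bref μ' μ' y - y with ht
  have hpt : ∀ u : Site (d + 1), colH (coDressKBmAt (toSite (ctrOff (d + 1) Lc)) Lc (KInvStep (d := d) Lc j)) Lc μ' y κ u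
      = -colH (coDressKBmAt (toSite (ctrOff (d + 1) Lc)) Lc (KInvStep (d := d) Lc j)) Lc μ' y κ (bref μ' κ u - (Lc : ℤ) • t) := by
    intro u
    rw [colH_refl_of_ne hLc j hκ y u]
    have e : bref μ' μ' y = y + t := by rw [ht]; abel
    rw [e, colH_translate (shiftK_coDressKBmAt_KInvStep (toSite (ctrOff (d + 1) Lc)) j) μ' y t κ (bref μ' κ u)]
  set e : Site (d + 1) ≃ Site (d + 1) := (Function.Involutive.toPerm (bref μ' κ) (bref_bref μ' κ)).trans (Equiv.subRight ((Lc : ℤ) • t)) with hedef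
  have he : ∀ u : Site (d + 1), e u = bref μ' κ u - (Lc : ℤ) • t := fun u => rfl
  set S := ∑' u, W u * colH (coDressKBmAt (toSite (ctrOff (d + 1) Lc)) Lc (KInvStep (d := d) Lc j)) Lc μ' y κ u with hS
  have h1 : S = -S := by
    calc S = ∑' u, -(W (e u) * colH (coDressKBmAt (toSite (ctrOff (d + 1) Lc)) Lc (KInvStep (d := d) Lc j)) Lc μ' y κ (e u)) := by
            refine tsum_congr fun u => ?_
            rw [he, hW u, hpt u]
            ring
      _ = -∑' u, W (e u) * colH (coDressKBmAt (toSite (ctrOff (d + 1) Lc)) Lc (KInvStep (d := d) Lc j)) Lc μ' y κ (e u) := tsum_neg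
      _ = -S := by rw [hS, e.tsum_eq (fun u => W u * colH (coDressKBmAt (toSite (ctrOff (d + 1) Lc)) Lc (KInvStep (d := d) Lc j)) Lc μ' y κ u)]
  linarith

/-- NOT IN PRINT; OUR BOOKKEEPING.  **WEIGHTS BLIND TO THE DATUM COORDINATE** read nothing on the transverse field legs: if `W` does not depend on `u_{μ′}`
(`W (Function.update u μ′ z) = W u`), then `Σ'_u W u·colH G_j Lc μ′ y κ u = 0` for every `κ ≠ μ′` — sheets, transverse lines, products of weights on the other axes. -/
theorem tsum_mul_colH_eq_zero_of_indep (hLc : Odd Lc) (j : ℕ) {μ' κ : Fin (d + 1)} (hκ : κ ≠ μ') (y : Site (d + 1)) {W : Site (d + 1) → ℝ}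
    (hW : ∀ u z, W (Function.update u μ' z) = W u) :
    ∑' u, W u * colH (coDressKBmAt (toSite (ctrOff (d + 1) Lc)) Lc (KInvStep (d := d) Lc j)) Lc μ' y κ u = 0 := by
  refine tsum_mul_colH_eq_zero_of_reflInvariant hLc j hκ y fun u => ?_
  have e : bref μ' κ u - (Lc : ℤ) • (bref μ' μ' y - y) = Function.update u μ' ((bref μ' κ u - (Lc : ℤ) • (bref μ' μ' y - y)) μ') := by
    funext i
    by_cases hi : i = μ'
    · subst hi; simp
    · rw [Function.update_of_ne hi, Pi.sub_apply, bref_apply_of_ne μ' κ u hi, Pi.smul_apply, bref_self_sub_apply_of_ne μ' y hi, smul_zero, sub_zero]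
  rw [e, hW]

end Summit.QuantumFields.BalabanUV.Beta.GAN24.TransverseFluxReflectionMultiplier

end
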